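import Literature.NumberTheory.EllipticCurves.GaloisStableDivisibleSubgroupProofs
import Literature.NumberTheory.EllipticCurves.GaloisStableDivisibleSubgroupNonabelianProofs
import Literature.NumberTheory.EllipticCurves.Kato2004.IwasawaH1ReductionKernel
import Literature.NumberTheory.EllipticCurves.TateModuleFreeProofs
import Literature.NumberTheory.EllipticCurves.RationalTateModuleLattices
import Mathlib.RingTheory.Nakayama
import HarnessLib

/-!
# `T_pE` has no proper non-zero saturated `Γ_ℚ`-stable `ℤ_p`-submodule — `V_pE` is an irreducible
# `ℚ_p[Γ_ℚ]`-module for every elliptic curve over `ℚ` (Serre 1968, IV §2.1), in the language of `T_pE`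

`Proofs` file (theorems only; no definition, no named fact) in topic `NumberTheory/EllipticCurves`,
the Tate-module form of the sibling `GaloisStableDivisibleSubgroupProofs` (a non-zero `Γ_ℚ`-stable
`p`-divisible `p`-primary subgroup of `E(ℚ̄)` contains `E[p]`). For an elliptic curve `E/ℚ`
(Weierstrass model `W` with `W.IsElliptic`) and a prime `p`:

* `WeierstrassCurve.tateModule_submodule_eq_top_of_stable_saturated` — **a `ℤ_p`-submodule
  `N ≤ T_pE` (`W.tateModule p`, the tree's coordinate model `lim← E[p^n]`) which is `Γ_ℚ`-stable,
  saturated (`p • a ∈ N → a ∈ N`) and non-zero is all of `T_pE`.** Equivalently the `ℚ_p`-linear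
  Galois representation `V_pE = ℚ_p ⊗ T_pE` has no `Γ_ℚ`-stable line: it is IRREDUCIBLE — Serre,
  *Abelian ℓ-adic representations and elliptic curves* (1968), Ch. IV §2.1 (irreducibility of `V_ℓ`
  through Shafarevich's finiteness theorem — the road followed by the sibling, down to the tree's
  `WeierstrassCurve.finite_isogenyClass_holds`), here for every `E/ℚ` (over `ℚ` no complex
  multiplication is rational, `not_hasRationalCM_holds`).
* `WeierstrassCurve.rationalTateModule_submodule_eq_top_of_stable` (appended) — the same in `V_pE`
  itself: a non-zero `ℚ_p`-subspace of `W.rationalTateModule p` stable under `W.rationalGaloisRepTate p`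
  is everything (every `v ∈ V_pE` is `p^{-s} • (1 ⊗ b)`, `RationalTateModuleLattices`).
* `WeierstrassCurve.tateModule_submodule_eq_bot_of_stable_of_smul_comm` (appended, `p` odd) — `T_pE` has
  no non-zero `Γ_ℚ`-stable `ℤ_p`-submodule with ABELIAN `Γ_ℚ`-action (Kato §13.8 p. 228, the input of
  `H⁰(ℚ, T ⊗ Λ/xΛ) = 0`, without irreducibility of `E[p]`; from the sibling
  `GaloisStableDivisibleSubgroupNonabelianProofs`).

## The proof

The union `D = ⋃_k proj_k(N) ⊆ E(ℚ̄)` of the coordinate images of `N` is a subgroup (the images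
increase: `a_k = (p a)_{k+1}`), `p`-primary (`a_k ∈ E[p^k]`), `p`-divisible (`a_k = p a_{k+1}`),
`Γ_ℚ`-stable and non-zero; by the sibling `E[p] ≤ D`. Saturation turns "`t_1 ∈ D`" into "`t_1 = b_1`
for some `b ∈ N`" (descend the level along `a = p b ⇒ b ∈ N`, the kernel of `a ↦ a_1` being `p T_pE`:
`TateModule.exists_prime_nsmul_eq_of_proj_one_eq_zero`), whence `T_pE = N + p T_pE`, and Nakayama
over the local ring `ℤ_p` (`T_pE` is finitely generated, `module_finite_tateModule_holds`; Mathlib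
`Submodule.le_of_le_smul_of_le_jacobson_bot`) gives `N = T_pE`.

## References

* [Serre1968] J.-P. Serre, *Abelian ℓ-adic representations and elliptic curves* (1968), Ch. IV §2.1
  (irreducibility of the `ℓ`-adic representation), Ch. I §1.1 (`T_ℓ`, `V_ℓ`).
* [SilvermanAEC2009] J. H. Silverman, *The Arithmetic of Elliptic Curves*, 2nd ed., III §7
  (`T_ℓ E`), Cor. IX.6.2 (through the sibling).
-/

noncomputable section

open scoped Classical AddSubgroup

universe u

namespace WeierstrassCurve

open Literature.NumberTheory.EllipticCurves

variable (W : WeierstrassCurve ℚ) [W.IsElliptic] {p : ℕ} [Fact p.Prime]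

/-- **Saturated `Γ_ℚ`-stable submodules of `T_pE` are `0` or `T_pE`** (every elliptic curve over
`ℚ`, every prime `p`): a `ℤ_p`-submodule `N ≤ T_pE` stable under `Γ_ℚ`, saturated
(`p • a ∈ N → a ∈ N`) and non-zero equals `T_pE` — i.e. **`V_pE` is an irreducible
`ℚ_p[Γ_ℚ]`-module**. Serre, *Abelian ℓ-adic representations* (1968), IV §2.1, by Shafarevich's
theorem; here through the sibling `geomTorsion_le_of_stable_divisible` applied to
`D = ⋃_k proj_k(N)`, the descent `E[p] ≤ D ⇒ T_pE = N + p T_pE` (saturation), and Nakayama over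
`ℤ_p`. [cite: Serre1968, Ch. IV §2.1] -/
theorem tateModule_submodule_eq_top_of_stable_saturated {N : Submodule ℤ_[p] (W.tateModule p)}
    (hstab : ∀ (σ : Field.absoluteGaloisGroup ℚ) (a : W.tateModule p), a ∈ N → σ • a ∈ N)
    (hsat : ∀ a : W.tateModule p, p • a ∈ N → a ∈ N) (hne : N ≠ ⊥) : N = ⊤ := by
  have hp : p.Prime := Fact.out
  -- the coordinate images `F k = proj_k(N)`, an increasing family of subgroups of `E(ℚ̄)`
  let F : ℕ → AddSubgroup W.geomPoints := fun k ↦ N.toAddSubgroup.map (TateModule.proj p k)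
  have hF : ∀ {k} {x : W.geomPoints}, x ∈ F k ↔ ∃ a ∈ N, TateModule.proj p k a = x := fun {k x} ↦ by
    constructor
    · rintro ⟨a, ha, rfl⟩; exact ⟨a, ha, rfl⟩
    · rintro ⟨a, ha, rfl⟩; exact ⟨a, ha, rfl⟩
  have hmono : Monotone F := by
    refine monotone_nat_of_le_succ fun k x hx ↦ ?_
    obtain ⟨a, ha, rfl⟩ := hF.mp hx
    refine hF.mpr ⟨p • a, N.toAddSubgroup.nsmul_mem ha p, ?_⟩
    rw [map_nsmul, TateModule.smul_proj_succ]
  set D : AddSubgroup W.geomPoints := ⨆ k, F k with hD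
  have hmemD : ∀ {x : W.geomPoints}, x ∈ D ↔ ∃ k, x ∈ F k := fun {x} ↦
    AddSubgroup.mem_iSup_of_directed hmono.directed_le
  -- `D` is `p`-primary, `p`-divisible, `Γ_ℚ`-stable, non-zero
  have hprim : ∀ P ∈ D, ∃ k : ℕ, p ^ k • P = 0 := fun P hP ↦ by
    obtain ⟨k, hk⟩ := hmemD.mp hP
    obtain ⟨a, -, rfl⟩ := hF.mp hk
    exact ⟨k, TateModule.pow_smul_proj k a⟩
  have hdiv : ∀ P ∈ D, ∃ Q ∈ D, p • Q = P := fun P hP ↦ by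
    obtain ⟨k, hk⟩ := hmemD.mp hP
    obtain ⟨a, ha, rfl⟩ := hF.mp hk
    exact ⟨TateModule.proj p (k + 1) a, hmemD.mpr ⟨k + 1, hF.mpr ⟨a, ha, rfl⟩⟩,
      TateModule.smul_proj_succ k a⟩
  have hstabD : ∀ (σ : Field.absoluteGaloisGroup ℚ) (P : W.geomPoints), P ∈ D → σ • P ∈ D := by
    intro σ P hP
    obtain ⟨k, hk⟩ := hmemD.mp hP
    obtain ⟨a, ha, rfl⟩ := hF.mp hk
    exact hmemD.mpr ⟨k, hF.mpr ⟨σ • a, hstab σ a ha,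
      TateModule.proj_smul_of_distribMulAction σ a k⟩⟩
  have hneD : D ≠ ⊥ := by
    intro hbot
    apply hne
    refine (Submodule.eq_bot_iff N).mpr fun a ha ↦ TateModule.ext fun k ↦ ?_
    have hmem : TateModule.proj p k a ∈ D := hmemD.mpr ⟨k, hF.mpr ⟨a, ha, rfl⟩⟩
    rw [hbot, AddSubgroup.mem_bot] at hmem
    rw [hmem, map_zero]
  -- the sibling: `E[p] ≤ D`
  have hE : geomTorsion W (p : ℤ) ≤ D := W.geomTorsion_le_of_stable_divisible hprim hdiv hstabD hneD
  -- descent of the level under saturation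
  have hdesc : ∀ (j : ℕ) (a : W.tateModule p), a ∈ N → p • TateModule.proj p (j + 1) a = 0 →
      ∃ b ∈ N, TateModule.proj p 1 b = TateModule.proj p (j + 1) a := by
    intro j
    induction j with
    | zero => exact fun a ha _ ↦ ⟨a, ha, rfl⟩
    | succ j ih =>
      intro a ha hpa
      have h1 : TateModule.proj p 1 a = 0 := by
        rw [← TateModule.pow_smul_proj_succ (j + 1) a, pow_succ, mul_smul, hpa, smul_zero]
      obtain ⟨b, hb, hbproj⟩ := TateModule.exists_prime_nsmul_eq_of_proj_one_eq_zero a h1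
      have hbN : b ∈ N := hsat b (by rw [hb]; exact ha)
      obtain ⟨b', hb'N, hb'⟩ := ih b hbN (by rw [hbproj]; exact hpa)
      exact ⟨b', hb'N, by rw [hb', hbproj]⟩
  -- `T_pE = N + p T_pE`
  have hsum : ∀ t : W.tateModule p, ∃ a ∈ N, ∃ u : W.tateModule p, t = a + p • u := by
    intro t
    have ht1 : TateModule.proj p 1 t ∈ D :=
      hE (by
        have h := TateModule.proj_mem_torsionBy 1 t
        rwa [pow_one] at h)
    obtain ⟨k, hk⟩ := hmemD.mp ht1
    obtain ⟨a, ha, hat⟩ := hF.mp hk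
    -- an element `b ∈ N` with `b_1 = t_1`
    obtain ⟨b, hbN, hb1⟩ : ∃ b ∈ N, TateModule.proj p 1 b = TateModule.proj p 1 t := by
      cases k with
      | zero =>
        refine ⟨0, N.zero_mem, ?_⟩
        rw [map_zero, ← hat, TateModule.proj_zero]
      | succ j =>
        have hpa : p • TateModule.proj p (j + 1) a = 0 := by
          rw [hat]
          have h := TateModule.pow_smul_proj 1 t
          rwa [pow_one] at h
        obtain ⟨b, hbN, hb⟩ := hdesc j a ha hpa
        exact ⟨b, hbN, by rw [hb, hat]⟩
    have h0 : TateModule.proj p 1 (t - b) = 0 := by rw [map_sub, hb1, sub_self]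
    obtain ⟨u, hu, -⟩ := TateModule.exists_prime_nsmul_eq_of_proj_one_eq_zero (t - b) h0
    exact ⟨b, hbN, u, by rw [hu, add_sub_cancel]⟩
  -- Nakayama over the local ring `ℤ_p`
  haveI : Module.Finite ℤ_[p] (W.tateModule p) := module_finite_tateModule_holds W p
  have hpI : (p : ℤ_[p]) ∈ IsLocalRing.maximalIdeal ℤ_[p] := by
    rw [PadicInt.maximalIdeal_eq_span_p]
    exact Ideal.mem_span_singleton_self _
  have hIJ : IsLocalRing.maximalIdeal ℤ_[p] ≤ Ideal.jacobson ⊥ := by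
    rw [IsLocalRing.jacobson_eq_maximalIdeal ⊥ bot_ne_top]
  have hNN : (⊤ : Submodule ℤ_[p] (W.tateModule p)) ≤
      N ⊔ IsLocalRing.maximalIdeal ℤ_[p] • (⊤ : Submodule ℤ_[p] (W.tateModule p)) := by
    intro t _
    obtain ⟨a, ha, u, rfl⟩ := hsum t
    refine Submodule.add_mem_sup ha ?_
    rw [← Nat.cast_smul_eq_nsmul ℤ_[p]]
    exact Submodule.smul_mem_smul hpI Submodule.mem_top
  exact eq_top_iff.mpr
    (Submodule.le_of_le_smul_of_le_jacobson_bot Module.Finite.fg_top hIJ hNN)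

/-! ## The same in the rational Tate module: `V_pE` is irreducible -/

/-- **`V_pE` is an irreducible `ℚ_p[Γ_ℚ]`-module** (every elliptic curve over `ℚ`, every prime
`p`): a `ℚ_p`-subspace `L ≤ V_pE = ℚ_p ⊗ T_pE` (`W.rationalTateModule p`) stable under
`ρ_{E,p} = W.rationalGaloisRepTate p` and non-zero is all of `V_pE`. Serre, *Abelian ℓ-adic
representations* (1968), IV §2.1. Proof: `N = {t ∈ T_pE | 1 ⊗ t ∈ L}` is a `Γ_ℚ`-stable saturated
non-zero `ℤ_p`-submodule (every `v ∈ V_pE` is `p^{-s} • (1 ⊗ b)`, the tree's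
`RationalTateModule.exists_eq_inv_pow_smul_toRational`), so `N = T_pE` by
`tateModule_submodule_eq_top_of_stable_saturated`, and then `L ∋ p^{-s} • (1 ⊗ b)` for all `s, b`.
[cite: Serre1968, Ch. IV §2.1] -/
theorem rationalTateModule_submodule_eq_top_of_stable
    {L : Submodule ℚ_[p] (W.rationalTateModule p)}
    (hstab : ∀ (σ : Field.absoluteGaloisGroup ℚ) (v : W.rationalTateModule p),
      v ∈ L → W.rationalGaloisRepTate p σ v ∈ L)
    (hne : L ≠ ⊥) : L = ⊤ := by
  have hp : p.Prime := Fact.out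
  have hp0 : (p : ℚ_[p]) ≠ 0 := Nat.cast_ne_zero.mpr hp.ne_zero
  have hρ : ∀ (σ : Field.absoluteGaloisGroup ℚ) (a : W.tateModule p),
      W.rationalGaloisRepTate p σ (TateModule.toRational p a) = TateModule.toRational p (σ • a) :=
    fun σ a ↦ rfl
  -- `N = {t | 1 ⊗ t ∈ L}`
  let N : Submodule ℤ_[p] (W.tateModule p) :=
    (L.restrictScalars ℤ_[p]).comap (TateModule.toRational p)
  have hN : ∀ {a : W.tateModule p}, a ∈ N ↔ TateModule.toRational p a ∈ L := fun {a} ↦ Iff.rfl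
  have hstabN : ∀ (σ : Field.absoluteGaloisGroup ℚ) (a : W.tateModule p), a ∈ N → σ • a ∈ N :=
    fun σ a ha ↦ hN.mpr (by rw [← hρ]; exact hstab σ _ (hN.mp ha))
  have hsatN : ∀ a : W.tateModule p, p • a ∈ N → a ∈ N := fun a ha ↦ by
    have h := L.smul_mem ((p : ℚ_[p])⁻¹) (hN.mp ha)
    rw [map_nsmul, ← Nat.cast_smul_eq_nsmul ℚ_[p], inv_smul_smul₀ hp0] at h
    exact hN.mpr h
  have hneN : N ≠ ⊥ := by
    intro hbot
    apply hne
    refine (Submodule.eq_bot_iff L).mpr fun v hv ↦ ?_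
    obtain ⟨s, b, rfl⟩ := RationalTateModule.exists_eq_inv_pow_smul_toRational p v
    have hb : TateModule.toRational p b ∈ L := by
      have h := L.smul_mem ((p : ℚ_[p]) ^ s) hv
      rwa [smul_inv_smul₀ (pow_ne_zero s hp0)] at h
    have hb0 : b = 0 := by
      have : b ∈ N := hN.mpr hb
      rw [hbot] at this
      exact (Submodule.mem_bot ℤ_[p]).mp this
    rw [hb0, map_zero, smul_zero]
  have hNtop := W.tateModule_submodule_eq_top_of_stable_saturated hstabN hsatN hneN
  refine eq_top_iff.mpr fun v _ ↦ ?_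
  obtain ⟨s, b, rfl⟩ := RationalTateModule.exists_eq_inv_pow_smul_toRational p v
  have hb : b ∈ N := by rw [hNtop]; exact Submodule.mem_top
  exact L.smul_mem _ (hN.mp hb)


/-! ## No `Γ_ℚ`-stable submodule of `T_pE` with abelian action (`p` odd) — Kato §13.8 -/

/-- **`T_pE` has no non-zero `Γ_ℚ`-stable `ℤ_p`-submodule on which `Γ_ℚ` acts through an abelian
quotient** (`p` odd, every elliptic curve over `ℚ`). This is the form in which Kato uses "the
representation of `Gal(ℚ̄/ℚ)` on `V(f)` is irreducible and is not abelian" to get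
`H⁰(ℚ, T ⊗ Λ/xΛ) = Hom_{O[Gal]}(Hom(Λ/xΛ, O), T) = 0` (Astérisque 295, §13.8, p. 228: the image of such a
homomorphism is a `Γ_ℚ`-stable submodule of `T` with abelian action), here WITHOUT irreducibility of
`E[p]`: the coordinate images `⋃_k proj_k(N)` form a non-zero `Γ_ℚ`-stable `p`-divisible subgroup of
`E[p^∞]` with commuting action, against `not_forall_smul_comm_of_stable_divisible`.
[cite: Kato2004Asterisque, §13.8 (p. 228)] -/
theorem tateModule_submodule_eq_bot_of_stable_of_smul_comm (hp2 : p ≠ 2)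
    {N : Submodule ℤ_[p] (W.tateModule p)}
    (hstab : ∀ (σ : Field.absoluteGaloisGroup ℚ) (a : W.tateModule p), a ∈ N → σ • a ∈ N)
    (hcomm : ∀ (σ τ : Field.absoluteGaloisGroup ℚ) (a : W.tateModule p), a ∈ N →
      σ • τ • a = τ • σ • a) : N = ⊥ := by
  by_contra hne
  -- the coordinate images `F k = proj_k(N)` and their union `D`
  let F : ℕ → AddSubgroup W.geomPoints := fun k ↦ N.toAddSubgroup.map (TateModule.proj p k)
  have hF : ∀ {k} {x : W.geomPoints}, x ∈ F k ↔ ∃ a ∈ N, TateModule.proj p k a = x := fun {k x} ↦ by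
    constructor
    · rintro ⟨a, ha, rfl⟩; exact ⟨a, ha, rfl⟩
    · rintro ⟨a, ha, rfl⟩; exact ⟨a, ha, rfl⟩
  have hmono : Monotone F := by
    refine monotone_nat_of_le_succ fun k x hx ↦ ?_
    obtain ⟨a, ha, rfl⟩ := hF.mp hx
    refine hF.mpr ⟨p • a, N.toAddSubgroup.nsmul_mem ha p, ?_⟩
    rw [map_nsmul, TateModule.smul_proj_succ]
  set D : AddSubgroup W.geomPoints := ⨆ k, F k with hD
  have hmemD : ∀ {x : W.geomPoints}, x ∈ D ↔ ∃ k, x ∈ F k := fun {x} ↦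
    AddSubgroup.mem_iSup_of_directed hmono.directed_le
  have hprim : ∀ P ∈ D, ∃ k : ℕ, p ^ k • P = 0 := fun P hP ↦ by
    obtain ⟨k, hk⟩ := hmemD.mp hP
    obtain ⟨a, -, rfl⟩ := hF.mp hk
    exact ⟨k, TateModule.pow_smul_proj k a⟩
  have hdiv : ∀ P ∈ D, ∃ Q ∈ D, p • Q = P := fun P hP ↦ by
    obtain ⟨k, hk⟩ := hmemD.mp hP
    obtain ⟨a, ha, rfl⟩ := hF.mp hk
    exact ⟨TateModule.proj p (k + 1) a, hmemD.mpr ⟨k + 1, hF.mpr ⟨a, ha, rfl⟩⟩,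
      TateModule.smul_proj_succ k a⟩
  have hstabD : ∀ (σ : Field.absoluteGaloisGroup ℚ) (P : W.geomPoints), P ∈ D → σ • P ∈ D := by
    intro σ P hP
    obtain ⟨k, hk⟩ := hmemD.mp hP
    obtain ⟨a, ha, rfl⟩ := hF.mp hk
    exact hmemD.mpr ⟨k, hF.mpr ⟨σ • a, hstab σ a ha,
      TateModule.proj_smul_of_distribMulAction σ a k⟩⟩
  have hneD : D ≠ ⊥ := by
    intro hbot
    apply hne
    refine (Submodule.eq_bot_iff N).mpr fun a ha ↦ TateModule.ext fun k ↦ ?_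
    have hmem : TateModule.proj p k a ∈ D := hmemD.mpr ⟨k, hF.mpr ⟨a, ha, rfl⟩⟩
    rw [hbot, AddSubgroup.mem_bot] at hmem
    rw [hmem, map_zero]
  have hcommD : ∀ (σ τ : Field.absoluteGaloisGroup ℚ) (P : W.geomPoints), P ∈ D →
      σ • τ • P = τ • σ • P := by
    intro σ τ P hP
    obtain ⟨k, hk⟩ := hmemD.mp hP
    obtain ⟨a, ha, rfl⟩ := hF.mp hk
    rw [← TateModule.proj_smul_of_distribMulAction, ← TateModule.proj_smul_of_distribMulAction,
      ← TateModule.proj_smul_of_distribMulAction, ← TateModule.proj_smul_of_distribMulAction,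
      hcomm σ τ a ha]
  exact W.not_forall_smul_comm_of_stable_divisible hp2 hprim hdiv hstabD hneD hcommD

end WeierstrassCurve

end
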